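import Mathlib.Algebra.BigOperators.Fin
import Mathlib.Data.Real.Basic
import Mathlib.Tactic.Linarith

/-!
# Crux `CubicForrelation.SignedCubicForrelationNotPrBPP` (stmt-QuantumAdvantage-13931)

Stub `stub_maxQuarterRule` of the line `Sketch` (K2, the ARGMAX QUARTER RULE of kernel descent;
sharpening found by triage r1-2, `Cruxes/SignedCubicForrelationNotPrBPP/Triage_r1_2_MaxQuarter.lean`).

Kernel descent writes the signed cubic Forrelation `Φ` on `n + 2` bits as the average of four quarter
forrelations `Φ_q`, `q ∈ Bool × Bool`, on `n` bits. The sign bookkeeping that makes the descent ONE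
recursive call per level is pure real arithmetic: four reals `Φ q₀ q₁ ∈ [-1, 1]` with average `≥ 3/5`,
and a quarter `p` whose modulus is within `2ε` of the maximal modulus (`ε < 1/15`, the slack of the
classical `Φ²`-estimator). Then `Φ p > 0` and `|Φ p| ≥ 3/5 - 2ε`, i.e. `p` is itself a YES instance of
the threshold-`(3/5 - 2ε)` problem.

Proof. If `Φ p ≤ 0` then `|Φ p| = -Φ p ≤ 1`, every `Φ q ≤ |Φ q| ≤ -Φ p + 2ε`, so the total
`Σ_q Φ q ≤ Φ p + 3 (-Φ p + 2ε) = -2 Φ p + 6ε ≤ 2 + 6ε < 12/5`, contradicting the average bound.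
If `|Φ p| < 3/5 - 2ε` then every `Φ q ≤ |Φ q| < 3/5` and again `Σ_q Φ q < 12/5`.
The NO-side statement `stub_maxQuarterRule_neg` is the rule applied to `-Φ`.

Mathlib only (`Fintype.sum_bool`, `le_abs_self`, `abs_of_nonpos`, `abs_neg`, `linarith`).
-/

set_option linter.dupNamespace false -- D-0017: single-problem summit ⇒ `QuantumAdvantage.QuantumAdvantage` by design

namespace Summit.QuantumAdvantage.QuantumAdvantage.Theorems.SignedCubicForrelationNotPrBPP

/-- ARGMAX QUARTER RULE (stub `stub_maxQuarterRule` of line `Sketch`, crux stmt-QuantumAdvantage-13931).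
Four reals `Φ q₀ q₁ ∈ [-1, 1]` with average `≥ 3/5`; `p = (p₀, p₁)` a quarter whose modulus is within
`2ε` of the maximal modulus, `ε < 1/15`. Then `Φ p > 0` and `|Φ p| ≥ 3/5 - 2ε` (ONE recursive call per
level of kernel descent). -/
theorem stub_maxQuarterRule :
    ∀ (Φ : Bool → Bool → ℝ) (ε : ℝ), ε < 1 / 15 → (∀ q₀ q₁, |Φ q₀ q₁| ≤ 1) →
      (3 / 5 : ℝ) ≤ (1 / 4) * ∑ q₀, ∑ q₁, Φ q₀ q₁ → ∀ p₀ p₁ : Bool,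
      (∀ q₀ q₁, |Φ q₀ q₁| ≤ |Φ p₀ p₁| + 2 * ε) →
      0 < Φ p₀ p₁ ∧ 3 / 5 - 2 * ε ≤ |Φ p₀ p₁| := by
  intro Φ ε hε hb havg p₀ p₁ hmax
  simp only [Fintype.sum_bool] at havg
  have l1 := le_abs_self (Φ true true)
  have l2 := le_abs_self (Φ true false)
  have l3 := le_abs_self (Φ false true)
  have l4 := le_abs_self (Φ false false)
  have m1 := hmax true true
  have m2 := hmax true false
  have m3 := hmax false true
  have m4 := hmax false false
  have bp := hb p₀ p₁
  constructor
  · by_contra h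
    have habs : |Φ p₀ p₁| = -Φ p₀ p₁ := abs_of_nonpos (not_lt.mp h)
    rcases p₀ with _ | _ <;> rcases p₁ with _ | _ <;> linarith
  · by_contra h
    have h' : |Φ p₀ p₁| < 3 / 5 - 2 * ε := not_le.mp h
    linarith

/-- The symmetric NO-side rule (apply `stub_maxQuarterRule` to `-Φ`): four reals in `[-1, 1]` with
average `≤ -3/5`, `p` a quarter of `2ε`-approximately maximal modulus, `ε < 1/15`; then `Φ p < 0` and
`|Φ p| ≥ 3/5 - 2ε`. -/
theorem stub_maxQuarterRule_neg :
    ∀ (Φ : Bool → Bool → ℝ) (ε : ℝ), ε < 1 / 15 → (∀ q₀ q₁, |Φ q₀ q₁| ≤ 1) →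
      (1 / 4) * ∑ q₀, ∑ q₁, Φ q₀ q₁ ≤ -(3 / 5 : ℝ) → ∀ p₀ p₁ : Bool,
      (∀ q₀ q₁, |Φ q₀ q₁| ≤ |Φ p₀ p₁| + 2 * ε) →
      Φ p₀ p₁ < 0 ∧ 3 / 5 - 2 * ε ≤ |Φ p₀ p₁| := by
  intro Φ ε hε hb havg p₀ p₁ hmax
  have key := stub_maxQuarterRule (fun q₀ q₁ => -Φ q₀ q₁) ε hε (by simpa using hb)
    (by
      simp only [Fintype.sum_bool] at havg ⊢
      linarith) p₀ p₁ (by simpa using hmax)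
  simp only [abs_neg, Left.neg_pos_iff] at key
  exact key

end Summit.QuantumAdvantage.QuantumAdvantage.Theorems.SignedCubicForrelationNotPrBPP
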